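import Literature.Probability.LatticeModels.LatticeGraph
import Mathlib.Algebra.BigOperators.Pi
import HarnessLib

/-!
# One step of the difference chain of two oriented walks: successors of `0` and of `e_i - e_j`

Topic `Literature/Probability/Percolation`.  Sorry-free, no named facts.  Elementary support for
the random-walk computations of Bock–Damron–Newman–Sidoravicius, *Percolation of finite clusters
and shielded paths*, J. Stat. Phys. 179 (2020), §3–§4: the difference `D = S' - S` of two
independent uniform oriented walks on `ℤ^d` moves in one step from `z` to `z + e_a - e_{a'}`,
`(a, a')` uniform on `[d]²`, and `h = ‖D‖₁ ∈ {0, 2, 4, …}`; the states at distance `2` are the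
`e_c - e_{c'}`, `c ≠ c'` (`IsS2`).  The transition counts (3.8) of the paper,
`P(h' = 0 | h = 0) = 1/d`, `P(h' = 0 | h = 2) = 1/d²`, `P(h' = 2 | h = 2) = (3d-4)/d²`, and the
bound "at most `4/d²`" for `P(h' = 2 | h = 4)` in case (C) of the proof of Lemma 4.1, are vendored
here as UPPER BOUNDS on successor counts, which is all the estimates of §4 use (we allow ourselves
`3d` in place of `3d - 4`):

* `succ_S2_eq_zero_iff`: from `e_i - e_j` the only step to `0` is `(a, a') = (j, i)`;
* `succ_S2_mem`: from `e_i - e_j`, a step to `S₂ ∪ {0}` has `a = a'`, `a = j` or `a' = i`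
  (so at most `3d` of the `d²` steps, `sum_sum_boole_succ_S2_le`);
* `succ_far_S2`: from the other ("far", `h = 4`) successors `e_i - e_j + e_a - e_{a'}` a step to
  `S₂` needs `b' ∈ {i, a}` and `b ∈ {j, a'}` (at most `4` steps, `sum_sum_boole_far_le`), and no
  step reaches `0` (`succ_far_ne_zero`).

The tool is the linear functional `massOn K v = Σ_{k ∈ K} v_k` ("`ℓ¹`-mass on a set of
coordinates"), which is `≤ 1` in absolute value on `S₂`.

## References

* B. Bock, M. Damron, C. M. Newman, V. Sidoravicius, J. Stat. Phys. 179 (2020) 789–807,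
  arXiv:1811.01678, §3 (3.8) and §4 (proof of Lemma 4.1, cases (A)–(C)). [BockEtAl2020]
-/

namespace Literature.Probability.Percolation

open Finset Literature.Probability.LatticeModels

variable {d : ℕ}

/-! ### The mass functional -/

/-- The total mass of `v` on the coordinates in `K`. [folklore] -/
def massOn (K : Finset (Fin d)) (v : Site d) : ℤ := ∑ k ∈ K, v k

/-- Additivity. [folklore] -/
theorem massOn_add (K : Finset (Fin d)) (v w : Site d) :
    massOn K (v + w) = massOn K v + massOn K w := by
  simp [massOn, Finset.sum_add_distrib]

/-- Subtractivity. [folklore] -/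
theorem massOn_sub (K : Finset (Fin d)) (v w : Site d) :
    massOn K (v - w) = massOn K v - massOn K w := by
  simp [massOn, Finset.sum_sub_distrib]

/-- Mass of `0`. [folklore] -/
@[simp] theorem massOn_zero (K : Finset (Fin d)) : massOn K (0 : Site d) = 0 := by
  simp [massOn]

/-- Mass of a unit coordinate vector. [folklore] -/
theorem massOn_single (K : Finset (Fin d)) (a : Fin d) :
    massOn K (Pi.single a (1 : ℤ) : Site d) = if a ∈ K then 1 else 0 := by
  simp [massOn]

/-! ### The set `S₂` of differences at `ℓ¹`-distance `2` -/

/-- `v` is a difference of two distinct unit coordinate vectors (`‖v‖₁ = 2` at level `0`).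
[cite: BockEtAl2020, §3 ("these x are all of the form e_i - e_j with i ≠ j")] -/
def IsS2 (v : Site d) : Prop :=
  ∃ c c' : Fin d, c ≠ c' ∧ v = Pi.single c 1 - Pi.single c' 1

/-- On `S₂` every mass functional takes values in `[-1, 1]`. [folklore] -/
theorem massOn_mem_of_isS2 {v : Site d} (hv : IsS2 v) (K : Finset (Fin d)) :
    -1 ≤ massOn K v ∧ massOn K v ≤ 1 := by
  obtain ⟨c, c', -, rfl⟩ := hv
  rw [massOn_sub, massOn_single, massOn_single]
  split_ifs <;> norm_num

/-- `e_a - e_{a'} = 0 ↔ a = a'` (from `0`, the steps back to `0` are the diagonal ones).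
[cite: BockEtAl2020, §3 (3.8)] -/
theorem single_sub_single_eq_zero_iff {a a' : Fin d} :
    (Pi.single a (1 : ℤ) : Site d) - Pi.single a' 1 = 0 ↔ a = a' := by
  constructor
  · intro h
    by_contra hne
    have h1 := congrArg (massOn {a}) h
    rw [massOn_sub, massOn_single, massOn_single, massOn_zero] at h1
    simp [Ne.symm hne] at h1
  · rintro rfl
    exact sub_self _

/-- Off the diagonal the step from `0` lands in `S₂`. [cite: BockEtAl2020, §3 (3.8)] -/
theorem isS2_single_sub_single {a a' : Fin d} (h : a ≠ a') :
    IsS2 ((Pi.single a (1 : ℤ) : Site d) - Pi.single a' 1) :=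
  ⟨a, a', h, rfl⟩

/-- `0 ∉ S₂`. [folklore] -/
theorem IsS2.ne_zero {v : Site d} (hv : IsS2 v) : v ≠ 0 := by
  obtain ⟨c, c', hne, rfl⟩ := hv
  exact fun h => hne (single_sub_single_eq_zero_iff.1 h)

/-! ### Successors of an `S₂` state `e_i - e_j` -/

/-- From `e_i - e_j` (`i ≠ j`) the step `(a, a')` leads to `0` iff `a = j` and `a' = i`
(`P(h' = 0 | h = 2) = 1/d²`). [cite: BockEtAl2020, §3 (3.8)] -/
theorem succ_S2_eq_zero_iff {i j : Fin d} (hij : i ≠ j) (a a' : Fin d) :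
    (Pi.single i (1 : ℤ) : Site d) - Pi.single j 1 + Pi.single a 1 - Pi.single a' 1 = 0 ↔
      a = j ∧ a' = i := by
  constructor
  · intro h
    have hi := congrArg (massOn {i}) h
    have hj := congrArg (massOn {j}) h
    simp only [massOn_add, massOn_sub, massOn_single, massOn_zero, Finset.mem_singleton,
      if_true, hij.symm, hij, if_false] at hi hj
    constructor
    · by_contra ha
      rw [if_neg ha] at hj
      split_ifs at hj <;> omega
    · by_contra ha'
      rw [if_neg ha'] at hi
      split_ifs at hi <;> omega
  · rintro ⟨rfl, rfl⟩
    abel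

/-- From `e_i - e_j` (`i ≠ j`), a step `(a, a')` into `S₂ ∪ {0}` is diagonal or undoes one of the
two unit vectors: `a = a'`, `a = j` or `a' = i`.  (The complement — `a ≠ a'`, `a ≠ j`, `a' ≠ i` —
are the steps to `h = 4`.) [cite: BockEtAl2020, §3 (3.8)] -/
theorem succ_S2_mem {i j : Fin d} (hij : i ≠ j) {a a' : Fin d}
    (h : IsS2 ((Pi.single i (1 : ℤ) : Site d) - Pi.single j 1 + Pi.single a 1 - Pi.single a' 1) ∨
      (Pi.single i (1 : ℤ) : Site d) - Pi.single j 1 + Pi.single a 1 - Pi.single a' 1 = 0) :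
    a = a' ∨ a = j ∨ a' = i := by
  by_contra hcon
  push Not at hcon
  obtain ⟨haa, haj, hai⟩ := hcon
  have hK : massOn {i, a}
      ((Pi.single i (1 : ℤ) : Site d) - Pi.single j 1 + Pi.single a 1 - Pi.single a' 1) = 2 := by
    simp only [massOn_add, massOn_sub, massOn_single, Finset.mem_insert, Finset.mem_singleton]
    simp [hij.symm, Ne.symm haj, hai, Ne.symm haa]
  rcases h with hS | h0
  · have := (massOn_mem_of_isS2 hS {i, a}).2
    omega
  · rw [h0, massOn_zero] at hK
    omega

/-- A "far" successor `e_i - e_j + e_a - e_{a'}` (`a ≠ a'`, `a ≠ j`, `a' ≠ i`) is not `0`.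
[cite: BockEtAl2020, §3 (3.8)] -/
theorem succ_far_ne_zero {i j a a' : Fin d} (hij : i ≠ j) (haa : a ≠ a') (haj : a ≠ j)
    (hai : a' ≠ i) :
    (Pi.single i (1 : ℤ) : Site d) - Pi.single j 1 + Pi.single a 1 - Pi.single a' 1 ≠ 0 :=
  fun h => by
    rcases succ_S2_mem hij (Or.inr h) with h' | h' | h'
    · exact haa h'
    · exact haj h'
    · exact hai h'

/-- A "far" successor is not in `S₂` either. [cite: BockEtAl2020, §3 (3.8)] -/
theorem succ_far_not_isS2 {i j a a' : Fin d} (hij : i ≠ j) (haa : a ≠ a') (haj : a ≠ j)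
    (hai : a' ≠ i) :
    ¬ IsS2 ((Pi.single i (1 : ℤ) : Site d) - Pi.single j 1 + Pi.single a 1 - Pi.single a' 1) :=
  fun h => by
    rcases succ_S2_mem hij (Or.inl h) with h' | h' | h'
    · exact haa h'
    · exact haj h'
    · exact hai h'

/-- From a far successor `y = e_i - e_j + e_a - e_{a'}` no step reaches `0`
(`P(h' = 0 | h = 4) = 0`). [cite: BockEtAl2020, §4 (proof of Lemma 4.1)] -/
theorem succ_far_step_ne_zero {i j a a' : Fin d} (hij : i ≠ j) (haa : a ≠ a') (haj : a ≠ j)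
    (hai : a' ≠ i) (b b' : Fin d) :
    (Pi.single i (1 : ℤ) : Site d) - Pi.single j 1 + Pi.single a 1 - Pi.single a' 1 +
      Pi.single b 1 - Pi.single b' 1 ≠ 0 := by
  intro h
  have h1 := congrArg (massOn {i, a}) h
  simp only [massOn_add, massOn_sub, massOn_single, massOn_zero, Finset.mem_insert,
    Finset.mem_singleton] at h1
  simp only [hij.symm, Ne.symm haj, hai, Ne.symm haa, or_self, if_false, true_or, or_true,
    if_true] at h1
  split_ifs at h1 <;> omega

/-- **Case (C) of BDNS Lemma 4.1**: from a far successor `y = e_i - e_j + e_a - e_{a'}` a step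
`(b, b')` into `S₂` must have `b' ∈ {i, a}` and `b ∈ {j, a'}` ("`X_3` must be `e_ℓ` or `e_m` and
`X'_3` must be `e_i` or `e_j`, giving a probability of `4/d²`"). [cite: BockEtAl2020, §4 (proof of Lemma 4.1, (A)–(C))] -/
theorem succ_far_S2 {i j a a' : Fin d} (hij : i ≠ j) (haa : a ≠ a') (haj : a ≠ j) (hai : a' ≠ i)
    {b b' : Fin d}
    (h : IsS2 ((Pi.single i (1 : ℤ) : Site d) - Pi.single j 1 + Pi.single a 1 - Pi.single a' 1 +
      Pi.single b 1 - Pi.single b' 1)) :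
    (b' = i ∨ b' = a) ∧ (b = j ∨ b = a') := by
  have h1 := (massOn_mem_of_isS2 h {i, a}).2
  have h2 := (massOn_mem_of_isS2 h {j, a'}).1
  simp only [massOn_add, massOn_sub, massOn_single, Finset.mem_insert, Finset.mem_singleton]
    at h1 h2
  simp only [hij.symm, Ne.symm haj, hai, Ne.symm haa, hij, haj, Ne.symm hai, haa, or_self,
    if_false, true_or, or_true, if_true] at h1 h2
  constructor
  · by_contra hb'
    rw [if_neg hb'] at h1
    split_ifs at h1 <;> omega
  · by_contra hb
    rw [if_neg hb] at h2
    split_ifs at h2 <;> omega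

/-! ### Counting successors (double sums of indicators, as they appear in first-step recursions) -/

/-- A double sum of indicators is the number of pairs satisfying the predicate. [folklore] -/
theorem sum_sum_boole_eq_card (P : Fin d → Fin d → Prop) [DecidablePred fun p : Fin d × Fin d => P p.1 p.2]
    [∀ a a', Decidable (P a a')] :
    ∑ a : Fin d, ∑ a' : Fin d, (if P a a' then (1 : ℝ) else 0) =
      ((univ.filter fun p : Fin d × Fin d => P p.1 p.2).card : ℝ) := by
  rw [Finset.natCast_card_filter, ← Finset.univ_product_univ, Finset.sum_product]

/-- The diagonal: `Σ_{a,a'} 1[a = a'] = d` (`P(h' = 0 | h = 0) = 1/d`). [cite: BockEtAl2020, §3 (3.8)] -/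
theorem sum_sum_boole_eq (d : ℕ) :
    ∑ a : Fin d, ∑ a' : Fin d, (if a = a' then (1 : ℝ) else 0) = d := by
  simp [Finset.sum_ite_eq]

/-- At most `3d` steps from `e_i - e_j` stay in `S₂ ∪ {0}`-candidates `{a = a'} ∪ {a = j} ∪ {a' = i}`
(the paper's exact count of `S₂`-steps is `3d - 4`). [cite: BockEtAl2020, §3 (3.8)] -/
theorem sum_sum_boole_succ_S2_le (i j : Fin d) :
    ∑ a : Fin d, ∑ a' : Fin d, (if a = a' ∨ a = j ∨ a' = i then (1 : ℝ) else 0) ≤ 3 * d := by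
  have h1 : ∀ a a' : Fin d, (if a = a' ∨ a = j ∨ a' = i then (1 : ℝ) else 0) ≤
      (if a = a' then 1 else 0) + (if a = j then 1 else 0) + (if a' = i then 1 else 0) := by
    intro a a'
    split_ifs <;> simp_all
  calc ∑ a : Fin d, ∑ a' : Fin d, (if a = a' ∨ a = j ∨ a' = i then (1 : ℝ) else 0)
      ≤ ∑ a : Fin d, ∑ a' : Fin d,
          ((if a = a' then (1 : ℝ) else 0) + (if a = j then 1 else 0) + (if a' = i then 1 else 0)) :=
        Finset.sum_le_sum fun a _ => Finset.sum_le_sum fun a' _ => h1 a a'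
    _ = 3 * d := by
        simp only [Finset.sum_add_distrib, Finset.sum_ite_eq, Finset.sum_ite_eq', Finset.mem_univ,
          if_true, Finset.sum_const, Finset.card_univ, Fintype.card_fin, nsmul_eq_mul]
        simp
        ring

/-- At most `4` steps from a far successor enter `S₂` (case (C): `{j, a'} × {i, a}`).
[cite: BockEtAl2020, §4 (proof of Lemma 4.1, (A)–(C))] -/
theorem sum_sum_boole_far_le (i a j a' : Fin d) :
    ∑ b : Fin d, ∑ b' : Fin d, (if (b' = i ∨ b' = a) ∧ (b = j ∨ b = a') then (1 : ℝ) else 0) ≤ 4 := by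
  rw [sum_sum_boole_eq_card]
  have hsub : (univ.filter fun p : Fin d × Fin d => (p.2 = i ∨ p.2 = a) ∧ (p.1 = j ∨ p.1 = a')) ⊆
      ({j, a'} : Finset (Fin d)) ×ˢ ({i, a} : Finset (Fin d)) := by
    intro p hp
    simp only [Finset.mem_filter, Finset.mem_univ, true_and] at hp
    simp only [Finset.mem_product, Finset.mem_insert, Finset.mem_singleton]
    exact ⟨hp.2, hp.1⟩
  have hcard := (Finset.card_le_card hsub).trans
    ((Finset.card_product _ _).trans_le (Nat.mul_le_mul Finset.card_le_two Finset.card_le_two))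
  exact_mod_cast hcard

/-- At most one step from `e_i - e_j` reaches `0`. [cite: BockEtAl2020, §3 (3.8)] -/
theorem sum_sum_boole_pair_le (j i : Fin d) :
    ∑ a : Fin d, ∑ a' : Fin d, (if a = j ∧ a' = i then (1 : ℝ) else 0) ≤ 1 := by
  rw [sum_sum_boole_eq_card]
  have hsub : (univ.filter fun p : Fin d × Fin d => p.1 = j ∧ p.2 = i) ⊆ {(j, i)} := by
    intro p hp
    simp only [Finset.mem_filter, Finset.mem_univ, true_and] at hp
    rw [Finset.mem_singleton]
    exact Prod.ext hp.1 hp.2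
  exact_mod_cast (Finset.card_le_card hsub).trans_eq (Finset.card_singleton _)

end Literature.Probability.Percolation
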